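import Literature.Geometry.DiscreteGeometry.ThreePointBoundGeneral
import Summits.Ventures.PackingBounds.Energy.TenPointCkEightFacc1
import Summits.Ventures.PackingBounds.Energy.TenPointCkEightFgrp2
import Summits.Ventures.PackingBounds.Energy.TenPointCkEightFblk0
import Summits.Ventures.PackingBounds.Energy.TenPointCkEightFblk1
import Summits.Ventures.PackingBounds.Energy.TenPointCkEightFblk2
import Summits.Ventures.PackingBounds.Energy.TenPointCkEightFblk3
import Summits.Ventures.PackingBounds.Energy.TenPointCkEightFblk4
import Summits.Ventures.PackingBounds.Energy.TenPointCkEightFblk5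
import HarnessLib

/-!
# `TenPointCkEight`: the tree's factored three-point function `threePointF 4 6 6 dcoKT8 gwKT8` equals the expansion `FexpKT8`

Framing: lottery ticket; floor = certified bounds/negative ranges. Venture `PackingBounds`, cell
`pub-packcert`, energy family E3PT (pub-packcert-energy gen 13; n = 4 kernel route = KERNEL-D6 data route + `threePointF 4`).
-/

noncomputable section

open Finset

namespace Summit.Ventures.PackingBounds.Energy.TenPointCkEight

open Literature.Geometry.DiscreteGeometry Literature.Geometry.DiscreteGeometry.BachocVallentin

/-- `Σ_{k<6} f k` written out. -/
private theorem sum_range_blocksT8 (f : ℕ → ℝ) : ∑ k ∈ range 6, f k = f 0 + f 1 + f 2 + f 3 + f 4 + f 5 := by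
  simp [Finset.sum_range_succ]

set_option maxRecDepth 20000 in
set_option maxHeartbeats 400000000 in
/-- The last staged partial sum lands on `FexpKT8` (`ring`). -/
theorem fgrp_top_eqT8 (u v t : ℝ) : Facc1KT8 u v t + Fgrp2KT8 u v t = FexpKT8 u v t := by
  unfold Facc1KT8 Fgrp2KT8 FexpKT8
  ring

/-- The tree's factored three-point function (`ThreePointBoundGeneral.threePointF`, `n = 4`) equals `FexpKT8` (blockwise identities
`fblk<k>_eq`, staged sums, `linear_combination`). -/
theorem threePointF_eqT8 (u v t : ℝ) : threePointF 4 6 6 dcoKT8 gwKT8 u v t = FexpKT8 u v t := by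
  rw [threePointF, sum_range_blocksT8, fblk0_eqT8, fblk1_eqT8, fblk2_eqT8, fblk3_eqT8, fblk4_eqT8, fblk5_eqT8]
  linear_combination fgrp0_eqT8 u v t + fgrp1_eqT8 u v t + fgrp2_eqT8 u v t + facc1_eqT8 u v t + fgrp_top_eqT8 u v t

end Summit.Ventures.PackingBounds.Energy.TenPointCkEight
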